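import Mathlib

/-!
# Objects of the line `Sketch-ideator4` (ternary cut counter ⇒ flow formulation) for the crux
`DivisionGap.ShadowBirkhoff` (stmt-ValiantsHypothesis-5069)

Definitions file (D-0016 `<RouteSlug>Defs` pattern) for the registered stubs of the crux skeleton
`Cruxes/ShadowBirkhoff/Lines/Sketch-ideator4.lean` (line lead prover-line-stmt-ValiantsHypothesis-5069-a3-0).
The stub theorems landed under `Theorems/DivisionGapShadowBirkhoffStub*.lean` refer to these objects by name,
so that they carry literally the registered signatures.  Nothing is asserted here (definitions only).

* `valueSet G wb wa` — the planar point set of a weighted 0/1 pattern `G ⊆ [N]²` (a face of the Birkhoff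
  polytope `DS_N`): the pairs `(∑ u, wb u (ρ u), ∑ u, wa u (ρ u))` over the permutations `ρ` supported in `G`
  (written exactly as in the landed padding theorem `stub_facePad`).
* `lowerVertices S` — the points of a planar set `S` that are the STRICT unique minimiser over `S` of
  `p ↦ p.2 − μ·p.1` for some real slope `μ` (the break points of the parametric minimum `min_{p ∈ S} (p.2 − μ p.1)`;
  for `S = valueSet G wb wa` these are the perfect matchings of `G` that are the unique optimum of the parametric
  assignment problem with costs `wa − μ·wb` at some `μ`, and they are vertices of the shadow of the face).
* `sdot`, `qdis`, `X2`, `Y4` — the abstract point model of the *ternary two-polarity cut counter* of the crux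
  idea card `Cruxes/ShadowBirkhoff/Ideas/ternary-cut-counter-fork.md` (ideator 4, round 2): digits `3^i`, a cut
  of the counter network `N_K` is a pair `(α, β)` of Boolean digit vectors, and its two capacities are (up to
  affine changes) `X2 = sdot α + sdot β` and `Y4 = 4·sdot α·sdot β + 2·qdis α β`.  The counter theorem (stub
  `stub_counter` of the skeleton) says that every diagonal cut `(D, D)` is the strict unique minimiser of
  `Y4 − μ·X2` for some integer slope `|μ| ≤ 3^(K+1)`, i.e. the parametric min-cut of `N_K` has `2^K` break points.
* `counterVal K μ`, `patternVal G wb wa μ` — the parametric value `min_{α,β} (Y4 − μ X2)` of the counter and the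
  parametric min-cost perfect-matching value of a weighted pattern; the line's bet C⁺ (stub `stub_flowEF`: a
  quasi-polynomial "flow-extended formulation" of the counter) is the statement that patterns of size
  `N ≤ 2^((log₂ K + k)^k)` have `patternVal = counterVal K + (affine)` on the slope window `|μ| ≤ 3^(K+2)`.
  The two propositions are written out inside the stub signatures (no `def : Prop` here).

References: P. Hrubeš, A. Yehudayoff, *Shadows of Newton polytopes*, CCC 2021 (Open Problem 1)
[HrubesYehudayoff2021]; the idea card and `Cruxes/ShadowBirkhoff/Sketch_ideator4.lean` (instance `K = 3`
kernel-checked there by `decide`).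
-/

set_option linter.dupNamespace false

noncomputable section

open scoped BigOperators

namespace Summit.ValiantsHypothesis.ValiantsHypothesis.Theorems.DivisionGapShadowBirkhoff

/-- The planar point set of the weighted pattern `G`: value pairs `(∑ wb, ∑ wa)` along the permutations
supported in `G` (the vertices of the face of `DS_N` cut out by `G`, projected by the two weight tables).
Written exactly as the set in the padding theorem `stub_facePad`. -/
def valueSet {N : ℕ} (G : Finset (Fin N × Fin N)) (wb wa : Fin N → Fin N → ℝ) : Set (ℝ × ℝ) :=
  {p : ℝ × ℝ | ∃ ρ : Equiv.Perm (Fin N), (∀ u, (u, ρ u) ∈ G) ∧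
      (∑ u, wb u (ρ u), ∑ u, wa u (ρ u)) = p}

/-- The points of a planar set `S` that are the strict unique minimiser over `S` of `p ↦ p.2 − μ·p.1` for
some real `μ` (break points of the parametric minimum; lower vertices of `conv S` with a non-vertical
supporting line). -/
def lowerVertices (S : Set (ℝ × ℝ)) : Set (ℝ × ℝ) :=
  {p : ℝ × ℝ | p ∈ S ∧ ∃ μ : ℝ, ∀ q ∈ S, q ≠ p → p.2 - μ * p.1 < q.2 - μ * q.1}

/-- Ternary digit sum `∑_{i : α i} 3^i` of a Boolean digit vector. -/
def sdot {K : ℕ} (α : Fin K → Bool) : ℤ :=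
  ∑ i : Fin K, if α i then (3 : ℤ) ^ (i : ℕ) else 0

/-- `∑_{i : α i ≠ β i} 9^i` — the squared digits on which two digit vectors differ. -/
def qdis {K : ℕ} (α β : Fin K → Bool) : ℤ :=
  ∑ i : Fin K, if α i ≠ β i then (9 : ℤ) ^ (i : ℕ) else 0

/-- Twice the abscissa of the cut `(α, β)` of the counter network: `X2 = sdot α + sdot β`. -/
def X2 {K : ℕ} (α β : Fin K → Bool) : ℤ :=
  sdot α + sdot β

/-- Four times the reduced ordinate of the cut `(α, β)`: `Y4 = 4·sdot α·sdot β + 2·qdis α β`. -/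
def Y4 {K : ℕ} (α β : Fin K → Bool) : ℤ :=
  4 * sdot α * sdot β + 2 * qdis α β

/-- Parametric value of the counter: `h_K(μ) = min_{(α, β)} (Y4 α β − μ·X2 α β)` (a minimum over the finite
nonempty type of digit-vector pairs, written as an indexed infimum in `ℝ`). -/
def counterVal (K : ℕ) (μ : ℝ) : ℝ :=
  ⨅ αβ : (Fin K → Bool) × (Fin K → Bool), ((Y4 αβ.1 αβ.2 : ℝ) - μ * (X2 αβ.1 αβ.2 : ℝ))

/-- Parametric min-cost perfect-matching value of the weighted pattern `G` at slope `μ`: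
`min over ρ supported in G of (∑ wa − μ·∑ wb)` (an indexed infimum in `ℝ`; it is the minimum when some
permutation is supported in `G`, and `0` by convention otherwise). -/
def patternVal {N : ℕ} (G : Finset (Fin N × Fin N)) (wb wa : Fin N → Fin N → ℝ) (μ : ℝ) : ℝ :=
  ⨅ ρ : {ρ : Equiv.Perm (Fin N) // ∀ u, (u, ρ u) ∈ G},
    ((∑ u, wa u (ρ.1 u)) - μ * ∑ u, wb u (ρ.1 u))

/-- Sanity check of the encoding (and the registered anchor of this definitions file): lower vertices of a
planar set are points of the set. [folklore] -/
theorem lowerVertices_subset (S : Set (ℝ × ℝ)) : lowerVertices S ⊆ S :=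
  fun _ hp => hp.1

end Summit.ValiantsHypothesis.ValiantsHypothesis.Theorems.DivisionGapShadowBirkhoff

end
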